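import Summits.KontsevichZagierPeriods.KontsevichZagierPeriods.Theses.RootDecompQuadraticDescent

/-!
# Route RootDecompQuadraticDescent — `KZDimTwoGlue` (item stmt-KontsevichZagierPeriods-28995)

GLUE of the gen-5 split of the shared hard core `KZDimTwo` (item 4280) over the PROVED dimension-1 floor:
`BakerFloorOne → QuadraticDescentOne → DescentTwoQ → KZDimTwo` (children 28992 · 28993 · 28994).
Proof (= `kzDimTwo_of_floor` / `kzDimTwo_of_item10622` of the decomp-kz lens-6 gen-5 node file
`run/shared/lean/pub/decomp-kz/decomp-kz-lens-6/g5/RootDecompQuadraticDescentBakerFloor.lean`, critic CLEARED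
2026-08-30T06:01:48Z, retargeted to the route declarations by name): instantiate `DescentTwoQ` at `R := KZ.relations`
(a two-sided ideal by the Fubini product, `KZ.mul_mem_relations_right_holds` / `…_left_holds`), with Coinc(relations, 1)
= `BakerFloorOne` and DecKer(relations, 1) = `QuadraticDescentOne` at `R := relations`; the conclusion Coinc(relations, 2)
is `KZDimTwo` (`KZ.Equivalent r r'` is membership of `[r] − [r']` in `relations`). Pure logic; standard axioms.
-/

namespace Summit.KontsevichZagierPeriods.RootDecompQuadraticDescent

open Literature.NumberTheory.Transcendental
open Summit.KontsevichZagierPeriods.KontsevichZagierPeriods.Theses.RootDecompQuadraticDescent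

/-- **KZDimTwoGlue** (item stmt-KontsevichZagierPeriods-28995): `BakerFloorOne → QuadraticDescentOne → DescentTwoQ → KZDimTwo`. -/
theorem kzDimTwoGlue_proof :
    Summit.KontsevichZagierPeriods.KontsevichZagierPeriods.Theses.RootDecompQuadraticDescent.KZDimTwoGlue := by
  unfold Summit.KontsevichZagierPeriods.KontsevichZagierPeriods.Theses.RootDecompQuadraticDescent.KZDimTwoGlue
  intro hB h₁ h₁₂
  unfold Summit.KontsevichZagierPeriods.KontsevichZagierPeriods.Theses.RootDecompQuadraticDescent.KZDimTwo
  unfold Summit.KontsevichZagierPeriods.KontsevichZagierPeriods.Theses.RootDecompQuadraticDescent.BakerFloorOne at hB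
  unfold Summit.KontsevichZagierPeriods.KontsevichZagierPeriods.Theses.RootDecompQuadraticDescent.QuadraticDescentOne at h₁
  unfold Summit.KontsevichZagierPeriods.KontsevichZagierPeriods.Theses.RootDecompQuadraticDescent.DescentTwoQ at h₁₂
  have hT : ∀ c ∈ KZ.relations, ∀ y : KZ.FormalRep, c * y ∈ KZ.relations ∧ y * c ∈ KZ.relations := fun c hc y =>
    ⟨KZ.mul_mem_relations_right_holds c y hc, KZ.mul_mem_relations_left_holds c y hc⟩
  have hC : ∀ ⦃n m : ℕ⦄, n ≤ 1 → m ≤ 1 → ∀ (r : KZ.IntegralRep n) (r' : KZ.IntegralRep m),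
      r.IsRational → r'.IsRational → r.value = r'.value → KZ.of r - KZ.of r' ∈ KZ.relations :=
    fun n m hn hm r r' hr hr' hv => hB hn hm r r' hr hr' hv
  intro n m hn hm r r' hr hr' hv
  exact h₁₂ KZ.relations le_rfl hT hC (h₁ KZ.relations le_rfl hT hC) hn hm r r' hr hr' hv

end Summit.KontsevichZagierPeriods.RootDecompQuadraticDescent
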